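import Summits.Ventures.LatticeQCDFlow.Scaling.HomStarLumping
import Summits.Ventures.LatticeQCDFlow.Scaling.ClockConditionedContraction

/-!
HONEST FRAMING: exact (Metropolis-corrected) sampling algorithms for lattice gauge theory; figures
of merit are autocorrelation/cost numbers at stated couplings and volumes; no continuum-physics
claim.

# HomStarExchangeableLaw — THE TRANSFER: FOR THE HOMOGENEOUS REPLICA-EXCHANGE STAR, THE LAW OF (HUB CONTENT, COMPOSITION) — I.E. OF EVERY EXCHANGEABLE (POOLED) OBSERVABLE — IS THE LAZY
# LUMPED STEP CHAIN'S, SO A DECAY `d_S(k) ≤ Mβᵏ` OF X5's STEP CHAIN (CHAPTER AD FILE 3) GIVES `‖Λ_*(δ_yPⁿ) − π_S‖_TV ≤ M·(1 − (t+h)(1−β))ⁿ`, `h = (1−t)w_0`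
# (lean-2 GEN-44, ours)

Venture-side (OURS).  Cell `lqcd-flow` (pub-lqcd), unit `pub-lqcd-lean-2-g44`, 2026-08-31.  Chapter AD, file 9 — OPEN-MATH item 1 (i) (c) in its honest form, second half.  File 8
proved the fibre sums `Σ_{z : Λz = x'} P(y,z) = t·A(Λy,x') + (1−t)(w_0·B(Λy,x') + (1−w_0)𝟙{Λy = x'})` for chapter U's homogeneous star `P`; with `q = t + (1−t)w_0` and `σ = t/q` this is
`q·S_σ(Λy,x') + (1−q)·𝟙{Λy = x'}`, `S_σ = σA + (1−σ)B` X5's step chain at swap odds `σ`.  §1 (generic): a lazy kernel `S' = qS + (1−q)I` has `μS'ⁿ = Σ_k C(n,k)qᵏ(1−q)ⁿ⁻ᵏ·μSᵏ`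
(binomial number of `S`-moves; Pascal), hence by convexity of total variation `d_{S'}(n) ≤ Σ_k C(n,k)qᵏ(1−q)ⁿ⁻ᵏ d_S(k)`, and a geometric decay `d_S(k) ≤ Mβᵏ` becomes
`d_{S'}(n) ≤ M(1 − q + qβ)ⁿ`.  §2: the push-forward `Λ_*ν(x) = Σ_{Λy = x} ν(y)` intertwines one step (`Λ_*(νP) = (Λ_*ν)S'`), hence all steps, so
`‖Λ_*(δ_yPⁿ) − π‖_TV = ‖δ_{Λy}S'ⁿ − π‖_TV ≤ d_{S'}(n)`.  §3: **`homStar_exchangeable_tvDist_le`** — the scheme's law of (hub content, composition) from any configuration is within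
`M(1 − (t + (1−t)w_0)(1−β))ⁿ` of `π_S` whenever `d_{S_σ}(k) ≤ Mβᵏ` (`β ∈ [0,1]`; chapter AD file 3 supplies `M = 2D/r`, `β = (1+(1−σ)r/48)⁻¹`).

* `lazy_stepLaw`, `lazy_lawAt_eq_binomial`, `lazy_worstTvDist_le`; `lumping_pushforward_single`, `homStar_pushforward_step`, `homStar_pushforward_lawAt`, **`homStar_exchangeable_tvDist_le`**.

Reading (no numerics implied): with AD3∕AD4 the pooled cold samples of the homogeneous star equilibrate in `O((K/((t+h)σ(1−σ)p̄))·log) = O((K/(p̄·min{t,h}))·log(K/(p̄ε)))` SCHEME steps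
(`p̄ ≥ p/2` at the likelihood-ratio normalisation) — the conjectured law-free order of OPEN-MATH item 1 (i), at EVERY swap rate, for exchangeable observables; the labelled chain's own
mixing (which replica holds which particle) is neither claimed nor needed for pooled estimators.  Literature grade (cell rule): OWN; nothing cited; no new bib keys.
-/

noncomputable section
open Finset Function
open Literature.Probability.MarkovChains

namespace Summit.Ventures.LatticeQCDFlow.Scaling

/-! ## §1 Lazy kernels: the binomial number of moves -/

section Lazy
variable {X : Type*} [Fintype X] [DecidableEq X] {S S' : X → X → ℝ} {q : ℝ}

/-- One lazy step: `νS' = q·νS + (1−q)·ν`. [ours] -/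
theorem lazy_stepLaw (hS' : ∀ x y, S' x y = q * S x y + (1 - q) * (if x = y then 1 else 0)) (ν : X → ℝ) :
    stepLaw S' ν = fun y => q * stepLaw S ν y + (1 - q) * ν y := by
  funext y
  simp only [stepLaw]
  simp_rw [hS', mul_add, sum_add_distrib]
  congr 1
  · rw [mul_sum]; exact sum_congr rfl fun x _ => by ring
  · rw [show (∑ x, ν x * ((1 - q) * if x = y then (1 : ℝ) else 0)) = ∑ x, (if x = y then (1 - q) * ν x else 0) from
      sum_congr rfl fun x _ => by split_ifs <;> ring, Finset.sum_ite_eq' univ y, if_pos (mem_univ _)]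

omit [DecidableEq X] in
/-- Linearity of the step in the initial law. [ours] -/
theorem stepLaw_sum_mul {ι : Type*} (S : X → X → ℝ) (s : Finset ι) (c : ι → ℝ) (ν : ι → X → ℝ) :
    stepLaw S (fun y => ∑ i ∈ s, c i * ν i y) = fun y => ∑ i ∈ s, c i * stepLaw S (ν i) y := by
  funext y
  simp only [stepLaw]
  rw [show (∑ x, (∑ i ∈ s, c i * ν i x) * S x y) = ∑ x, ∑ i ∈ s, c i * (ν i x * S x y) from
    sum_congr rfl fun x _ => by rw [sum_mul]; exact sum_congr rfl fun i _ => by ring, sum_comm]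
  exact sum_congr rfl fun i _ => by rw [mul_sum]

/-- **The binomial representation:** `μS'ⁿ = Σ_{k=0}^{n} C(n,k)qᵏ(1−q)ⁿ⁻ᵏ·μSᵏ`. [ours] -/
theorem lazy_lawAt_eq_binomial (hS' : ∀ x y, S' x y = q * S x y + (1 - q) * (if x = y then 1 else 0)) (μ : X → ℝ) (n : ℕ) :
    lawAt S' μ n = fun y => ∑ k ∈ range (n + 1), ((n.choose k : ℝ) * q ^ k * (1 - q) ^ (n - k)) * lawAt S μ k y := by
  induction n with
  | zero => funext y; simp [lawAt_zero]
  | succ n ih =>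
    funext y
    rw [lawAt_succ, ih, lazy_stepLaw hS', stepLaw_sum_mul]
    simp only []
    have hQ : ∀ k, stepLaw S (lawAt S μ k) y = lawAt S μ (k + 1) y := fun k => by rw [lawAt_succ]
    simp only [hQ]
    -- the target, split by Pascal's rule `C(n+1,k+1) = C(n,k) + C(n,k+1)` and the end terms
    rw [Finset.sum_range_succ' (fun k => ((n + 1).choose k : ℝ) * q ^ k * (1 - q) ^ (n + 1 - k) * lawAt S μ k y)]
    have hpas : ∀ k, ((n + 1).choose (k + 1) : ℝ) = (n.choose k : ℝ) + (n.choose (k + 1) : ℝ) :=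
      fun k => by rw [Nat.choose_succ_succ']; push_cast; ring
    simp only [hpas, add_mul, Finset.sum_add_distrib]
    rw [Finset.sum_range_succ (fun k => (n.choose (k + 1) : ℝ) * q ^ (k + 1) * (1 - q) ^ (n + 1 - (k + 1)) * lawAt S μ (k + 1) y)]
    rw [Nat.choose_succ_self, Nat.cast_zero, zero_mul, zero_mul, zero_mul, add_zero]
    -- the `(1−q)·Σ` part, split off its `k = 0` term and shift
    rw [mul_sum, mul_sum]
    rw [Finset.sum_range_succ' (fun k => (1 - q) * ((n.choose k : ℝ) * q ^ k * (1 - q) ^ (n - k) * lawAt S μ k y))]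
    have e1 : ∀ k ∈ range (n + 1), q * ((n.choose k : ℝ) * q ^ k * (1 - q) ^ (n - k) * lawAt S μ (k + 1) y)
        = (n.choose k : ℝ) * q ^ (k + 1) * (1 - q) ^ (n + 1 - (k + 1)) * lawAt S μ (k + 1) y := by
      intro k hk
      rw [show n + 1 - (k + 1) = n - k by omega, pow_succ]; ring
    have e2 : ∀ k ∈ range n, (1 - q) * ((n.choose (k + 1) : ℝ) * q ^ (k + 1) * (1 - q) ^ (n - (k + 1)) * lawAt S μ (k + 1) y)
        = (n.choose (k + 1) : ℝ) * q ^ (k + 1) * (1 - q) ^ (n + 1 - (k + 1)) * lawAt S μ (k + 1) y := by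
      intro k hk
      have hk' : k + 1 ≤ n := by have := mem_range.mp hk; omega
      rw [show n + 1 - (k + 1) = (n - (k + 1)) + 1 by omega, pow_succ]; ring
    rw [sum_congr rfl e1, sum_congr rfl e2]
    simp only [Nat.choose_zero_right, Nat.cast_one, pow_zero, one_mul, mul_one, Nat.sub_zero]
    rw [pow_succ]
    ring

/-- **Geometric decay survives the lazy time change:** `d_S(k) ≤ Mβᵏ` for all `k` (`0 ≤ β`) and `0 ≤ q ≤ 1` ⇒ `d_{S'}(n) ≤ M(1 − q + qβ)ⁿ` (any reference vector `π`). [ours] -/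
theorem lazy_worstTvDist_le (hS' : ∀ x y, S' x y = q * S x y + (1 - q) * (if x = y then 1 else 0)) (hq0 : 0 ≤ q) (hq1 : q ≤ 1)
    {π : X → ℝ} {M β : ℝ} (hβ : 0 ≤ β) (hdec : ∀ k, worstTvDist S π k ≤ M * β ^ k) (n : ℕ) :
    worstTvDist S' π n ≤ M * (1 - q + q * β) ^ n := by
  classical
  -- the binomial weights
  set b : ℕ → ℝ := fun k => (n.choose k : ℝ) * q ^ k * (1 - q) ^ (n - k) with hb
  have hb0 : ∀ k, 0 ≤ b k := fun k => by rw [hb]; exact mul_nonneg (mul_nonneg (Nat.cast_nonneg _) (pow_nonneg hq0 _)) (pow_nonneg (by linarith) _)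
  have hb1 : ∑ k ∈ range (n + 1), b k = 1 := by
    have := (add_pow q (1 - q) n).symm
    rw [show q + (1 - q) = 1 by ring, one_pow] at this
    rw [← this]; exact sum_congr rfl fun k _ => by rw [hb]; ring
  have hbβ : ∑ k ∈ range (n + 1), b k * (M * β ^ k) = M * (1 - q + q * β) ^ n := by
    rw [show (1 - q + q * β) = q * β + (1 - q) by ring, add_pow]
    rw [mul_sum]; exact sum_congr rfl fun k _ => by rw [hb, mul_pow]; ring
  refine Real.iSup_le (fun x => ?_) ?_
  · rw [lazy_lawAt_eq_binomial hS']
    have hπ : π = fun y => ∑ k ∈ range (n + 1), b k * π y := by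
      funext y; rw [← sum_mul, hb1, one_mul]
    rw [hπ]
    calc tvDist (fun y => ∑ k ∈ range (n + 1), b k * lawAt S (Pi.single x 1) k y) (fun y => ∑ k ∈ range (n + 1), b k * π y)
        ≤ ∑ k ∈ range (n + 1), b k * tvDist (lawAt S (Pi.single x 1) k) π := clock_tvDist_sum_le _ (fun k _ => hb0 k) _ _
      _ ≤ ∑ k ∈ range (n + 1), b k * (M * β ^ k) :=
          sum_le_sum fun k _ => mul_le_mul_of_nonneg_left ((tvDist_single_le_worstTvDist S π k x).trans (hdec k)) (hb0 k)
      _ = M * (1 - q + q * β) ^ n := hbβ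
  · have h0 := (worstTvDist_nonneg S π 0).trans (hdec 0)
    rw [pow_zero, mul_one] at h0
    exact mul_nonneg h0 (pow_nonneg (by nlinarith) _)

end Lazy

/-! ## §2 The push-forward through the lumping -/

section Push
variable {S : Type*} [Fintype S] [DecidableEq S] {K m : ℕ} {μ : Fin (K + 1) → S → ℝ} {M : Fin (K + 1) → S → S → ℝ} {w : Fin (K + 1) → ℝ} {t : ℝ}
variable (κ : Fin m → Fin K)
variable {X : Type*} [Fintype X] [DecidableEq X] {hub : X → S} {comp : X → S → ℕ} {acc : S → S → ℝ} {Kh : (S → ℕ) → S → S → ℝ} {Ast Bst Sl : X → X → ℝ}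
variable {Λ : (Fin (K + 1) → S) → X}

omit κ in
omit [Fintype X] in
/-- The push-forward of a point mass is the point mass at the image. [ours] -/
theorem lumping_pushforward_single (y : Fin (K + 1) → S) (x' : X) :
    ∑ z ∈ univ.filter (fun z => Λ z = x'), (Pi.single y (1 : ℝ) : (Fin (K + 1) → S) → ℝ) z = (Pi.single (Λ y) (1 : ℝ) : X → ℝ) x' := by
  classical
  by_cases h : Λ y = x'
  · rw [Finset.sum_eq_single_of_mem y (mem_filter.mpr ⟨mem_univ _, h⟩) (fun z _ hz => by simp [hz])]
    simp [h]
  · rw [Finset.sum_eq_zero (fun z hz => ?_)]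
    · rw [Pi.single_apply, if_neg (Ne.symm h)]
    · have hz' := (mem_filter.mp hz).2
      have : z ≠ y := fun e => h (e ▸ hz')
      simp [this]

/-- **One step intertwines:** `Λ_*(νP) = (Λ_*ν)·S_l` with `S_l(x,x') = t·A(x,x') + (1−t)(w_0·B(x,x') + (1−w_0)𝟙{x = x'})` the lazy lumped kernel. [ours] -/
theorem homStar_pushforward_step (hm : 1 ≤ m) (hμ : ∀ k x, 0 < μ k x) (hhom : ∀ i : Fin K, μ i.succ = μ 1) (hw1 : ∑ k, w k = 1)
    (hM0 : ∀ u v, M 0 u v = μ 0 v) (hidle : ∀ i : Fin K, ∀ u v, M i.succ u v = if v = u then 1 else 0)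
    {c : ℕ} (hunif : ∀ i : Fin K, (univ.filter fun r : Fin m => κ r = i).card = c)
    (hacc : ∀ u v, acc u v = min 1 (μ 0 v * μ 1 u / (μ 0 u * μ 1 v)))
    (hKoff : ∀ N h v, h ≠ v → Kh N h v = if N h = 0 then 0 else (N v : ℝ) / K * acc h v) (hKdiag : ∀ N h, Kh N h h = 1 - ∑ v ∈ univ.erase h, Kh N h v)
    (hA : ∀ x x', Ast x x' = if comp x' = comp x then Kh (comp x) (hub x) (hub x') else 0)
    (hB : ∀ x x', Bst x x' = μ 0 (hub x') * (if comp x' + Pi.single (hub x) 1 = comp x + Pi.single (hub x') 1 then 1 else 0))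
    (hSl : ∀ x x', Sl x x' = t * Ast x x' + (1 - t) * (w 0 * Bst x x' + (1 - w 0) * (if x = x' then 1 else 0)))
    (hΛh : ∀ y, hub (Λ y) = y 0) (hΛc : ∀ y v, comp (Λ y) v = (univ.filter fun k : Fin (K + 1) => y k = v).card)
    (hinj : ∀ x x', hub x = hub x' → comp x = comp x' → x = x')
    (ν : (Fin (K + 1) → S) → ℝ) (x' : X) :
    ∑ z ∈ univ.filter (fun z => Λ z = x'),
        stepLaw (fun y z => t * ptGraphSwap μ (fun r : Fin m => (((0 : Fin (K + 1)), (κ r).succ) : Fin (K + 1) × Fin (K + 1))) (fun _ : Fin m => Equiv.refl S) y z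
          + (1 - t) * prodKernel w M y z) ν z
      = stepLaw Sl (fun x => ∑ y ∈ univ.filter (fun y => Λ y = x), ν y) x' := by
  classical
  simp only [stepLaw]
  -- exchange the sums and use the fibre sums of file 8
  rw [Finset.sum_comm' (t' := univ) (s' := fun y => univ.filter (fun z => Λ z = x')) (fun y z => by simp)]
  have hfib : ∀ y, ∑ z ∈ univ.filter (fun z => Λ z = x'), ν y * (t * ptGraphSwap μ (fun r : Fin m => (((0 : Fin (K + 1)), (κ r).succ) : Fin (K + 1) × Fin (K + 1)))
        (fun _ : Fin m => Equiv.refl S) y z + (1 - t) * prodKernel w M y z) = ν y * Sl (Λ y) x' := by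
    intro y
    rw [← mul_sum, homStar_fibre_step κ hm hμ hhom hw1 hM0 hidle hunif hacc hKoff hKdiag hA hB hΛh hΛc hinj y x', hSl]
  rw [sum_congr rfl fun y _ => hfib y]
  -- regroup the configurations by their image
  rw [← Finset.sum_fiberwise univ Λ (fun y => ν y * Sl (Λ y) x')]
  refine sum_congr rfl fun x _ => ?_
  rw [sum_mul]
  exact sum_congr rfl fun y hy => by rw [(mem_filter.mp hy).2]

/-- **All steps intertwine:** `Λ_*(νPⁿ) = (Λ_*ν)S_lⁿ`. [ours] -/
theorem homStar_pushforward_lawAt (hm : 1 ≤ m) (hμ : ∀ k x, 0 < μ k x) (hhom : ∀ i : Fin K, μ i.succ = μ 1) (hw1 : ∑ k, w k = 1)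
    (hM0 : ∀ u v, M 0 u v = μ 0 v) (hidle : ∀ i : Fin K, ∀ u v, M i.succ u v = if v = u then 1 else 0)
    {c : ℕ} (hunif : ∀ i : Fin K, (univ.filter fun r : Fin m => κ r = i).card = c)
    (hacc : ∀ u v, acc u v = min 1 (μ 0 v * μ 1 u / (μ 0 u * μ 1 v)))
    (hKoff : ∀ N h v, h ≠ v → Kh N h v = if N h = 0 then 0 else (N v : ℝ) / K * acc h v) (hKdiag : ∀ N h, Kh N h h = 1 - ∑ v ∈ univ.erase h, Kh N h v)
    (hA : ∀ x x', Ast x x' = if comp x' = comp x then Kh (comp x) (hub x) (hub x') else 0)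
    (hB : ∀ x x', Bst x x' = μ 0 (hub x') * (if comp x' + Pi.single (hub x) 1 = comp x + Pi.single (hub x') 1 then 1 else 0))
    (hSl : ∀ x x', Sl x x' = t * Ast x x' + (1 - t) * (w 0 * Bst x x' + (1 - w 0) * (if x = x' then 1 else 0)))
    (hΛh : ∀ y, hub (Λ y) = y 0) (hΛc : ∀ y v, comp (Λ y) v = (univ.filter fun k : Fin (K + 1) => y k = v).card)
    (hinj : ∀ x x', hub x = hub x' → comp x = comp x' → x = x')
    (ν : (Fin (K + 1) → S) → ℝ) (n : ℕ) :
    (fun x' => ∑ z ∈ univ.filter (fun z => Λ z = x'),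
        lawAt (fun y z => t * ptGraphSwap μ (fun r : Fin m => (((0 : Fin (K + 1)), (κ r).succ) : Fin (K + 1) × Fin (K + 1))) (fun _ : Fin m => Equiv.refl S) y z
          + (1 - t) * prodKernel w M y z) ν n z)
      = lawAt Sl (fun x => ∑ y ∈ univ.filter (fun y => Λ y = x), ν y) n := by
  induction n with
  | zero => funext x'; simp [lawAt_zero]
  | succ n ih =>
    funext x'
    rw [lawAt_succ, lawAt_succ, ← ih]
    exact homStar_pushforward_step κ hm hμ hhom hw1 hM0 hidle hunif hacc hKoff hKdiag hA hB hSl hΛh hΛc hinj _ x'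

end Push

/-! ## §3 The transfer of the step law to exchangeable observables -/

section Transfer
variable {S : Type*} [Fintype S] [DecidableEq S] {K m : ℕ} {μ : Fin (K + 1) → S → ℝ} {M : Fin (K + 1) → S → S → ℝ} {w : Fin (K + 1) → ℝ} {t : ℝ}
variable (κ : Fin m → Fin K)
variable {X : Type*} [Fintype X] [DecidableEq X] {hub : X → S} {comp : X → S → ℕ} {acc : S → S → ℝ} {Kh : (S → ℕ) → S → S → ℝ} {Ast Bst Sst : X → X → ℝ}
variable {Λ : (Fin (K + 1) → S) → X}

/-- **THE EXCHANGEABLE LAW OF THE HOMOGENEOUS STAR FOLLOWS THE LUMPED STEP CHAIN:** if X5's step chain at swap odds `σ = t/(t + (1−t)w_0)` satisfies `d_S(k) ≤ Mβᵏ` (`0 ≤ β`, any reference vector `π`), then from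
every configuration `y` the law of (hub content, composition) after `n` scheme steps is within `M·(1 − (t + (1−t)w_0)(1−β))ⁿ` of `π` in total variation. [ours] -/
theorem homStar_exchangeable_tvDist_le (hm : 1 ≤ m) (hμ : ∀ k x, 0 < μ k x) (hhom : ∀ i : Fin K, μ i.succ = μ 1) (hw0 : ∀ k, 0 ≤ w k) (hw1 : ∑ k, w k = 1)
    (ht1 : t ≤ 1)
    (hM0 : ∀ u v, M 0 u v = μ 0 v) (hidle : ∀ i : Fin K, ∀ u v, M i.succ u v = if v = u then 1 else 0)
    {c : ℕ} (hunif : ∀ i : Fin K, (univ.filter fun r : Fin m => κ r = i).card = c)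
    (hacc : ∀ u v, acc u v = min 1 (μ 0 v * μ 1 u / (μ 0 u * μ 1 v)))
    (hKoff : ∀ N h v, h ≠ v → Kh N h v = if N h = 0 then 0 else (N v : ℝ) / K * acc h v) (hKdiag : ∀ N h, Kh N h h = 1 - ∑ v ∈ univ.erase h, Kh N h v)
    (hA : ∀ x x', Ast x x' = if comp x' = comp x then Kh (comp x) (hub x) (hub x') else 0)
    (hB : ∀ x x', Bst x x' = μ 0 (hub x') * (if comp x' + Pi.single (hub x) 1 = comp x + Pi.single (hub x') 1 then 1 else 0))
    (hS : ∀ x x', Sst x x' = t / (t + (1 - t) * w 0) * Ast x x' + (1 - t / (t + (1 - t) * w 0)) * Bst x x')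
    (hq : 0 < t + (1 - t) * w 0)
    (hΛh : ∀ y, hub (Λ y) = y 0) (hΛc : ∀ y v, comp (Λ y) v = (univ.filter fun k : Fin (K + 1) => y k = v).card)
    (hinj : ∀ x x', hub x = hub x' → comp x = comp x' → x = x')
    {π : X → ℝ} {Mdec β : ℝ} (hβ0 : 0 ≤ β) (hdec : ∀ k, worstTvDist Sst π k ≤ Mdec * β ^ k)
    (y : Fin (K + 1) → S) (n : ℕ) :
    tvDist (fun x' => ∑ z ∈ univ.filter (fun z => Λ z = x'),
        lawAt (fun a b => t * ptGraphSwap μ (fun r : Fin m => (((0 : Fin (K + 1)), (κ r).succ) : Fin (K + 1) × Fin (K + 1))) (fun _ : Fin m => Equiv.refl S) a b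
          + (1 - t) * prodKernel w M a b) (Pi.single y 1) n z) π
      ≤ Mdec * (1 - (t + (1 - t) * w 0) * (1 - β)) ^ n := by
  classical
  -- the lazy lumped kernel and its two readings
  obtain ⟨Sl, hSl⟩ : ∃ Sl : X → X → ℝ, ∀ x x', Sl x x' = t * Ast x x' + (1 - t) * (w 0 * Bst x x' + (1 - w 0) * (if x = x' then 1 else 0)) :=
    ⟨_, fun _ _ => rfl⟩
  have hSl' : ∀ x x', Sl x x' = (t + (1 - t) * w 0) * Sst x x' + (1 - (t + (1 - t) * w 0)) * (if x = x' then 1 else 0) := by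
    intro x x'
    rw [hSl, hS]
    have hq' : (t + (1 - t) * w 0) ≠ 0 := hq.ne'
    field_simp
    ring
  -- the push-forward identity and the point mass
  rw [homStar_pushforward_lawAt κ hm hμ hhom hw1 hM0 hidle hunif hacc hKoff hKdiag hA hB hSl hΛh hΛc hinj (Pi.single y 1) n]
  have hδ : (fun x => ∑ y' ∈ univ.filter (fun y' => Λ y' = x), (Pi.single y (1 : ℝ) : (Fin (K + 1) → S) → ℝ) y') = Pi.single (Λ y) 1 :=
    funext fun x => lumping_pushforward_single y x
  rw [hδ]
  -- the lazy transfer of the decay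
  have hq1 : t + (1 - t) * w 0 ≤ 1 := by
    have : w 0 ≤ 1 := by
      calc w 0 ≤ ∑ k, w k := single_le_sum (fun k _ => hw0 k) (mem_univ 0)
        _ = 1 := hw1
    nlinarith [hw0 0]
  have h := lazy_worstTvDist_le hSl' hq.le hq1 hβ0 hdec n
  rw [show 1 - (t + (1 - t) * w 0) + (t + (1 - t) * w 0) * β = 1 - (t + (1 - t) * w 0) * (1 - β) by ring] at h
  exact (tvDist_single_le_worstTvDist Sl π n (Λ y)).trans h

end Transfer

end Summit.Ventures.LatticeQCDFlow.Scaling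

end
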